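import Mathlib
import Literature.MathematicalPhysics.QuantumFieldTheory.Balaban1983to89.Beta.VectorTailsDipole
import Literature.MathematicalPhysics.QuantumFieldTheory.Balaban1983to89.Beta.BubbleTransfer

/-!
# (W3a)₀ vector road, node VECTOR-TAILS-PROP12 — the `ℤ⁴`-POINT ADAPTER: the four decay rows
# `d0 / d1 / d1× / d2×` of the average-first scalar wall, per base point, read off the entries of
# the covariant propagator `𝒢 = Δ_a⁻¹` inside the faithful box of a torus

HONEST FRAMING (verbatim, binding for this lineage).  «discharging `BetaPertH` makes Bałaban's UV
stability UNCONDITIONAL — a real constructive-QFT result; it is NOT the continuum limit and NOT the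
Clay problem.»  ABSOLUTE RULE (verbatim).  «No internally-minted statement may enter as a cited
fact. Every hypothesis is either kernel-proved in this package or a verbatim quotation of a
PUBLISHED theorem with page reference. The manuscript(s) under audit are NOT citable for their own
disputed steps — they are the thing under adjudication; programme-internal (2001/route/tribunal)
claims are never citable.»  This file cites NOTHING: every declaration is `[folklore]` bookkeeping,
kernel-checked; the two printed displays it leans on — [B5, (1.110)–(1.114)] = `B5.Prop12Printed`
and [B5, (1.126)–(1.127)] = `B5.Kernel126_127Printed` (B5 = T. Bałaban, Propagators and
renormalization transformations for lattice gauge theories I, Comm. Math. Phys. 95 (1984) 17–40,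
pp. 35–36, 38) — enter ONLY as the named hypotheses `h12`, `h126` of the theorems, for the readings
`VectorTailsLoc.fam` / `VectorTailsLoc.kfam`, and are NEVER discharged here.

Companion of `Beta/VectorTails.lean`, `Beta/VectorTailsCov.lean`, `Beta/VectorTailsLoc.lean`
(`legs_uniform`: the value leg `d0` and the observation-bond difference leg `d1` of the ENTRIES of
`B5Prop11Plancherel.calG n hn M a ha = (B5DeltaA169.DeltaA)⁻¹` at `U = 1`, per base point,
uniformly in the instance) and `Beta/VectorTailsDipole.lean` (`legs_uniform₂`: the source-bond
difference and the mixed observation/source second difference).  Those four statements are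
torus-intrinsic: the separation is `tdist x₀ x = ‖liftZ (x − x₀)‖_∞` and the envelope argument is
`PoissonInterior.nrm (liftZ (x − x₀))`.  The consumer — the average-first scalar wall
`Beta/SquareTableAvgFirst.oneLoopDrift_of_scalarBounds_avgFirst` (RULING (R14-6)) and the volume
seam typed by the an4 lineage in the same binder shapes — indexes its kernels by points
`v : DyadicShell.Pt = Fin 4 → ℤ` of `ℤ⁴`, steps by `BubbleTransfer.unitVec ρ = Pi.single ρ 1`,
measures by `DyadicShell.supNorm v`, and asks, for a kernel `G_{n,b} : Pt → ℝ` per scale `n` and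
base point `b`, with a shift `sh n b` of the base point by `e_μ` (`μ ≠ ν` fixed directions):

* `d0 : v ≠ 0 → |G_{n,b} v| ≤ A₀ e^{−(δ/n)‖v‖} / ‖v‖²`,
* `d1 : v ≠ 0 → |G_{n,b}(v + e_ρ) − G_{n,b} v| ≤ A₁ e^{−(δ/n)‖v‖} / ‖v‖³`,
* `d1× : v ≠ 0 → |G_{n,sh b} v − G_{n,b} v| ≤ A₃ e^{−(δ/n)‖v‖} / ‖v‖³`,
* `d2× : v ≠ 0 → |G_{n,b}(v+e_μ+e_ν) − G_{n,b}(v+e_μ) − (G_{n,sh b}(v+e_ν) − G_{n,sh b} v)| ≤ A₂ e^{−(δ/n)‖v‖} / ‖v‖⁴`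

(torus side: the same inequalities `∀ᶠ` in the volume, RULING (R13-1) «T ↗ ℤ⁴ first»).

## What this file does (all `[folklore]`, kernel-checked, no cited facts)

THE DICTIONARY (§1–§2).  A base point is a bond `(x₀, ν₀)` of the fine torus
`T = Π_μ ℤ/(n M_μ)` together with the observed component `κ`; the point `v ∈ ℤ⁴` is read as the
torus site `x₀ + castT v` (reduction mod `n M_μ`), and the kernel is the READING
`rdM n M G x₀ κ ν₀ φ v = n² · φ (G ((x₀ + castT v, κ), (x₀, ν₀)))` of a bond-indexed kernel `G`
(`rd n hn M a ha = rdM n M 𝒢`) through a real-valued additive functional `φ : ℂ →+ ℝ` with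
`|φ z| ≤ ‖z‖` (`Complex.reAddGroupHom`, `Complex.imAddGroupHom`; `𝒢` at `U = 1` is real, so
`φ = re` IS the entry — not needed and not claimed here).  The factor `n² = η⁻²` is the
normalisation in which `𝒢` is `O(1)` at unit distance (the suppliers carry `η²`).  The shifted
base point is `(x₀ + e_μ, ν₀)` with the same `κ`.  Inside the FAITHFUL BOX
`InBox N v : 2 (‖v‖_∞ + 1) < N_μ ∀ μ` the reduction is inverted by the centred lift
(`liftZ_castT_of_inBox`, from `VectorTails.liftZ_eq_of_castT_eq`), so that
`tdist x₀ (x₀ + castT v) = ‖v‖_∞`, `nrm (liftZ (castT v)) = ‖v‖_∞` for `v ≠ 0`, and the same for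
`v + e_μ` (`‖v + e_μ‖_∞ ≥ ‖v‖_∞ − 1`, `nrm (v + e_μ) ≥ ‖v‖_∞ / 2`:
`PoissonInterior.nrm_shift_ge_half`).  At `d = 4`, `PoissonInterior.supNorm = DyadicShell.supNorm`
and `BubbleTransfer.unitVec ρ = Pi.single ρ 1` hold by `rfl`, and
`castT (BubbleTransfer.unitVec ρ) = B5Prop11Plancherel.unitVec _ ρ` by `VectorTails.castT_single`.

THE FOUR ROWS (§3–§5).  `profile_transport` (§3): a supplier bound
`‖X‖ ≤ A η² e^{−(δ′/n) T} / ρ^k` with `‖v‖_∞ ≤ T + 1`, `‖v‖_∞/2 ≤ ρ`, `δ ≤ δ′` gives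
`n² ‖X‖ ≤ 2^k e^{δ′} A · e^{−(δ/n)‖v‖_∞} / ‖v‖_∞^k` (`n ≥ 1`).  `rows_of_legs` (§4, the
combinatorial core, for ANY bond-indexed kernel `G` on one torus): the value / observation-
difference legs (the shape of `VectorTailsLoc.legs_uniform`) and the source-difference / mixed legs
(the shape of `VectorTailsDipole.legs_uniform₂`) at rates `δ₁, δ₂ ≥ δ` give the four rows of
`rdM n M G` at every `v ≠ 0` in the faithful box, with constants `4e^{δ₁}A₀`, `8e^{δ₁}A₁`,
`8e^{δ₂}A₂ + 8e^{δ₁}A₁`, `16e^{δ₂}A₃`.  Derivations: `d0`/`d1` = value / observation legs at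
`x = x₀ + castT v`; `d1×` = (source-bond difference at `x = x₀ + castT v + e_μ`) + (observation
difference at `x₀ + castT v`); `d2×` = minus the mixed difference at `x = x₀ + castT v + e_μ`,
`μ′ = ν`.  Then `legs_pt` (§5, THE MAIN STATEMENT): for every family `i ↦ (n_i, M_i)` of
instances (the consumer's index: scale AND volume), ASSUMING `B5.Prop12Printed (fam …)` and
`B5.Kernel126_127Printed (kfam …)` BY NAME, there are `δ > 0` and `A₀, A₁, A₂, A₃ ≥ 0` chosen
BEFORE the instance, the base point, the functional `φ` and the point `v`, such that for every
instance `i`, every `(x₀, κ, ν₀)`, every `φ` with `|φ z| ≤ ‖z‖` and every `v ≠ 0` in the faithful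
box of `T_i`, the four rows above hold for `G = rd (n_i) … x₀ κ ν₀ φ`, `sh : x₀ ↦ x₀ + e_μ`,
literally in the consumer's atoms (`DyadicShell.supNorm`, `BubbleTransfer.unitVec`,
`Real.exp (-(δ / n) * supNorm v) / supNorm v ^ k`); `legs_pt_A` repackages the constants as one
`A : ℕ → ℝ`, `0 ≤ A j`, in the consumer's numbering (`A 0, A 1, A 3, A 2`).

THE VOLUME FORM (§6) AND THE WALL FORM (§7).  `eventually_inBox`: if the sides `n M_μ` tend to
`∞` along a filter `l` of volumes then every fixed `v` is eventually in the faithful box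
((R13-1) «T ↗ ℤ⁴ first»); `legs_pt_eventually`: the four rows `∀ᶠ t in l` for any volume
parametrisation of the family and base points `t ↦ x₀ t`.  `wall_rows` (§7): for the family
indexed by `(n, t) ∈ ℕ+ × τ` and ANY instance map of the wall — base points
`b : κB ↦ (X₀ (n,t) b, kk n b, nn n b)`, sets `Bset n`, and a relabelling `sh n : Equiv.Perm κB`
which on `Bset n` translates the source site by `e_μ` and keeps component and bond direction —
the torus-side hypotheses `d0T / d1T / d1×T / d2×T` of the volume seam hold LITERALLY
(`∀ n ≥ 2, ∀ b ∈ Bset n, ∀ v ≠ 0, ∀ᶠ t in l, …`, one `A : ℕ → ℝ≥0`, one `δ > 0`) for the kernel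
family `GT n b t v = n² φ (𝒢_{(n,t)} ((X₀ b + castT v, kk b), (X₀ b, nn b)))`.  The remaining
seam inputs — the infinite-volume limits `hG` and the free-comparison rows `h0T … h2×T` — are not
this file's (see below).

BLOCK-TRANSLATION COVARIANCE AND WRAPPED SHIFTS (§8–§9, v1.1).  The wall's relabelling `sh n` must
PRESERVE the finite set `Bset n` (its `hshB`), so on a finite block it cannot be the strict
translation `X₀ (sh b) = X₀ b + e_μ` of `wall_rows` at every base point: the natural instance is
the CYCLIC shift inside one `n`-block, which differs from the translation by a block translation
`n e_μ` at the wrap points.  §8 proves, on the tree's operator, that this is immaterial at `U = 1`: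
`S_ν^n 𝒢 = 𝒢 S_ν^n` (`shiftM_pow_mul_calG`: by `dftV_mul_shiftM` the translation by one block
side `n e_ν` is the Fourier multiplier `e^{2πi n p_ν/(n M_ν)} = e^{2πi v(q_ν)/M_ν}`, CONSTANT on
the cosets `p = v(q) + M k` of `B5Prop11Plancherel.emb`, hence commuting with the block-diagonal
`Ĝ = calGhat`), so the entries are invariant under simultaneous translation of both sites by the
block lattice `blockSteps n M = Σ_ν ℤ · n e_ν` (`calG_blockShift`, `calG_translate`;
`castT (n z) ∈ blockSteps`), and the reading `rd` is invariant under block translation of the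
base point (`rd_translate`).  `wall_rows_mod` (§9) is `wall_rows` with the shift hypothesis
weakened to `X₀ (sh b) − (X₀ b + e_μ) ∈ blockSteps` (translation by `e_μ` MODULO block
translations — the cyclic shift qualifies), same conclusion, same constants.

## What it does NOT do (honest scope)

* It does not choose the consumer's base-point type `κB`, its sets `Bset n`, weights, or its
  permutation `sh n`; it proves the rows for EVERY bond `(x₀, ν₀)`, component `κ` and functional
  `φ`, with the shift `x₀ ↦ x₀ + e_μ`, and (§7, §9) for EVERY instance map
  `(X₀, kk, nn, φ, Bset, sh)` whose shift translates the source site by `e_μ` (§9: modulo block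
  translations) — which map is the wall's is the consumer's.
* The rows `h0 / h1 / h1× / h2×` (comparison with the free massless propagator `gFree` at rate
  `D_j / n^{2,3,3,4}`) are a DIFFERENT statement (a free comparison, `SquareTable` §15) and are not
  addressed by this lineage; nor is the infinite-volume limit `T ↗ ℤ⁴` of the readings (the seam's
  `hG`), nor any identification of `𝒢` with the wall's `G_{n,b}` beyond the displayed reading.
* Outside the faithful box nothing is asserted (the periodic reading of a torus kernel on all of
  `ℤ⁴` does not decay); (R13-1) takes the volume to infinity first, which §6–§7 serve.
* Nothing here discharges `B5.Prop12Printed` / `B5.Kernel126_127Printed`; no continuum limit, no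
  Clay statement: closing `BetaPertH` makes Bałaban's UV stability unconditional, nothing more.
-/

open Finset Matrix Filter Topology
open scoped BigOperators Matrix

namespace Literature.MathematicalPhysics.QuantumFieldTheory.Balaban1983to89.Beta.VectorTailsPt

open Literature.MathematicalPhysics.QuantumFieldTheory.Balaban1983to89.B5Prop11Plancherel
open Literature.MathematicalPhysics.QuantumFieldTheory.Balaban1983to89.Beta.VectorTails
  (liftZ castT castT_add castT_single liftZ_eq_of_castT_eq)
open Literature.MathematicalPhysics.QuantumFieldTheory.Balaban1983to89.Beta.VectorTailsCov (tdist)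
open Literature.MathematicalPhysics.QuantumFieldTheory.Balaban1983to89.Beta.VectorTailsLoc
  (fam kfam legs_uniform)
open Literature.MathematicalPhysics.QuantumFieldTheory.Balaban1983to89.Beta.VectorTailsDipole
  (legs_uniform₂)
open Literature.MathematicalPhysics.QuantumFieldTheory.Balaban1983to89.Beta.PoissonInterior
  (supNorm nrm natAbs_le_supNorm supNorm_eq_zero_iff supNorm_neg supNorm_add_le
    supNorm_single_one one_le_nrm nrm_shift_ge_half)

noncomputable section

/-! ## §1 The faithful box of a torus and the centred-lift dictionary (any dimension) -/

section Box

variable {d : ℕ}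

/-- THE FAITHFUL BOX of the torus `Π_μ ℤ/N_μ` for a lattice point `v`: `v` and all its unit
neighbours lie strictly inside the centred fundamental domain, `2 (‖v‖_∞ + 1) < N_μ`. [folklore] -/
def InBox (N : Fin d → ℕ) (v : Fin d → ℤ) : Prop := ∀ μ, 2 * (supNorm v + 1) < N μ

/-- `‖v + e_μ‖_∞ ≤ ‖v‖_∞ + 1`. [folklore] -/
theorem supNorm_add_single_le (v : Fin d → ℤ) (μ : Fin d) :
    supNorm (v + Pi.single μ 1) ≤ supNorm v + 1 :=
  (supNorm_add_le _ _).trans (Nat.add_le_add_left (supNorm_single_one μ) _)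

/-- `‖v‖_∞ ≤ ‖v + e_μ‖_∞ + 1`. [folklore] -/
theorem supNorm_le_add_single (v : Fin d → ℤ) (μ : Fin d) :
    supNorm v ≤ supNorm (v + Pi.single μ 1) + 1 := by
  have h := supNorm_add_le (v + Pi.single μ 1) (-(Pi.single μ 1 : Fin d → ℤ))
  rw [add_neg_cancel_right, supNorm_neg] at h
  exact h.trans (Nat.add_le_add_left (supNorm_single_one μ) _)

/-- a point of smaller sup norm lies in the same faithful box. [folklore] -/
theorem InBox.mono {N : Fin d → ℕ} {v w : Fin d → ℤ} (hv : InBox N v) (hw : supNorm w ≤ supNorm v) :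
    InBox N w := fun μ => lt_of_le_of_lt (by omega) (hv μ)

variable {N : Fin d → ℕ}

/-- the torus separation of `x₀` and `x₀ + castT w` is `‖liftZ (castT w)‖_∞`. [folklore] -/
theorem tdist_add_castT (x₀ : (μ : Fin d) → ZMod (N μ)) (w : Fin d → ℤ) :
    tdist x₀ (x₀ + castT N w) = supNorm (liftZ (castT N w)) := by
  rw [tdist, add_sub_cancel_left]

/-- `castT (v + e_μ) = castT v + e_μ` (torus unit vector). [folklore] -/
theorem castT_add_single (v : Fin d → ℤ) (μ : Fin d) :
    castT N (v + Pi.single μ 1) = castT N v + unitVec N μ := by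
  rw [castT_add, castT_single]; rfl

variable [hN : ∀ μ, NeZero (N μ)]

/-- INSIDE THE FAITHFUL BOX THE REDUCTION IS INVERTED BY THE CENTRED LIFT: `liftZ (castT w) = w`
for every `w` with `‖w‖_∞ ≤ ‖v‖_∞ + 1`, `v` in the box. [folklore] -/
theorem liftZ_castT_of_inBox {v w : Fin d → ℤ} (hv : InBox N v) (hw : supNorm w ≤ supNorm v + 1) :
    liftZ (castT N w) = w :=
  liftZ_eq_of_castT_eq rfl fun μ => by
    have h1 := natAbs_le_supNorm w μ
    have h2 := hv μ
    omega

/-- … hence the separation is `‖w‖_∞` inside the faithful box. [folklore] -/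
theorem tdist_add_castT_of_inBox (x₀ : (μ : Fin d) → ZMod (N μ)) {v w : Fin d → ℤ}
    (hv : InBox N v) (hw : supNorm w ≤ supNorm v + 1) :
    tdist x₀ (x₀ + castT N w) = supNorm w := by
  rw [tdist_add_castT, liftZ_castT_of_inBox hv hw]

/-- the centred lift of `(x₀ + castT w) − x₀` is `w` inside the faithful box. [folklore] -/
theorem liftZ_add_castT_sub_of_inBox (x₀ : (μ : Fin d) → ZMod (N μ)) {v w : Fin d → ℤ}
    (hv : InBox N v) (hw : supNorm w ≤ supNorm v + 1) :
    liftZ (x₀ + castT N w - x₀) = w := by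
  rw [add_sub_cancel_left, liftZ_castT_of_inBox hv hw]

omit hN in
/-- `nrm w = ‖w‖_∞` off the origin. [folklore] -/
theorem nrm_eq_supNorm_of_ne_zero {w : Fin d → ℤ} (hw : w ≠ 0) : nrm w = (supNorm w : ℝ) := by
  unfold nrm
  refine max_eq_right ?_
  have h : supNorm w ≠ 0 := fun h => hw (supNorm_eq_zero_iff.mp h)
  exact_mod_cast Nat.one_le_iff_ne_zero.mpr h

omit hN in
/-- `1 ≤ ‖w‖_∞` off the origin. [folklore] -/
theorem one_le_supNorm_of_ne_zero {w : Fin d → ℤ} (hw : w ≠ 0) : (1 : ℝ) ≤ (supNorm w : ℝ) := by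
  rw [← nrm_eq_supNorm_of_ne_zero hw]; exact one_le_nrm w

end Box

/-! ## §2 `d = 4`: the consumer's atoms -/

section Four

/-- `PoissonInterior.supNorm` (lit1's `ℤ^d` sup norm at `d = 4`) IS `DyadicShell.supNorm`
(the wall's). [folklore] -/
theorem supNorm_eq_dyadic (v : DyadicShell.Pt) : supNorm v = DyadicShell.supNorm v := rfl

/-- the wall's unit vector is `Pi.single μ 1`. [folklore] -/
theorem unitVec_eq_single (μ : Fin 4) : BubbleTransfer.unitVec μ = Pi.single μ 1 := rfl

/-- the wall's unit step reduces to the torus unit vector. [folklore] -/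
theorem castT_unitVec (N : Fin 4 → ℕ) (μ : Fin 4) :
    castT N (BubbleTransfer.unitVec μ) = unitVec N μ :=
  castT_single N μ

/-- `castT (v + e_ρ) = castT v + e_ρ` in the wall's atoms. [folklore] -/
theorem castT_add_unitVec (N : Fin 4 → ℕ) (v : DyadicShell.Pt) (ρ : Fin 4) :
    castT N (v + BubbleTransfer.unitVec ρ) = castT N v + unitVec N ρ :=
  castT_add_single v ρ

end Four

/-! ## §3 The reading and the profile transport -/

section Reading

/-- THE READING of a bond-indexed kernel `G` on the fine torus as a kernel on `ℤ⁴` per base point: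
`rdM n M G x₀ κ ν₀ φ v = n² · φ (G ((x₀ + castT v, κ), (x₀, ν₀)))`, `φ : ℂ →+ ℝ` a real reading of
a complex entry (`re`, `im`), `n² = η⁻²` the `O(1)` normalisation. [folklore] -/
def rdM (n : ℕ) (M : Fin 4 → ℕ) (G : Matrix (Tor (fine n M) × Fin 4) (Tor (fine n M) × Fin 4) ℂ)
    (x₀ : Tor (fine n M)) (κ ν₀ : Fin 4) (φ : ℂ →+ ℝ) (v : DyadicShell.Pt) : ℝ :=
  ((n : ℕ) : ℝ) ^ 2 * φ (G (x₀ + castT (fine n M) v, κ) (x₀, ν₀))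

variable (n : ℕ) [NeZero n] (hn : 1 ≤ n) (M : Fin 4 → ℕ) [hM : ∀ μ, NeZero (M μ)] (a : ℝ)
  (ha : 0 < a)

/-- THE READING of the entries of `𝒢 = Δ_a⁻¹ = B5Prop11Plancherel.calG n hn M a ha` (at `U = 1`):
`rd n hn M a ha = rdM n M 𝒢`. [folklore] -/
def rd : Tor (fine n M) → Fin 4 → Fin 4 → (ℂ →+ ℝ) → DyadicShell.Pt → ℝ :=
  rdM n M (calG n hn M a ha)

/-- `rd` unfolds to `rdM` of `calG`. [folklore] -/
theorem rd_eq : rd n hn M a ha = rdM n M (calG n hn M a ha) := rfl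

end Reading

section Transport

/-- the real part reads complex entries with `|re z| ≤ ‖z‖`. [folklore] -/
theorem abs_re_le (z : ℂ) : |Complex.reAddGroupHom z| ≤ ‖z‖ := Complex.abs_re_le_norm z

/-- the imaginary part reads complex entries with `|im z| ≤ ‖z‖`. [folklore] -/
theorem abs_im_le (z : ℂ) : |Complex.imAddGroupHom z| ≤ ‖z‖ := Complex.abs_im_le_norm z

/-- scalarisation of a reading: `|n² φ X| ≤ n² ‖X‖`. [folklore] -/
theorem abs_sq_mul_le (n : ℕ) {φ : ℂ →+ ℝ} (hφ : ∀ z, |φ z| ≤ ‖z‖) (X : ℂ) :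
    |((n : ℕ) : ℝ) ^ 2 * φ X| ≤ ((n : ℕ) : ℝ) ^ 2 * ‖X‖ := by
  rw [abs_mul, abs_of_nonneg (by positivity : (0 : ℝ) ≤ ((n : ℕ) : ℝ) ^ 2)]
  exact mul_le_mul_of_nonneg_left (hφ X) (by positivity)

/-- EXPONENTIAL WEAKENING: `e^{−(δ′/n) T} ≤ e^{δ′} e^{−(δ/n) S}` for `S ≤ T + 1`, `0 ≤ δ ≤ δ′`,
`0 ≤ S`, `n ≥ 1`. [folklore] -/
theorem exp_transport {n δ δ' S T : ℝ} (hn : 1 ≤ n) (hδ : 0 ≤ δ) (hδδ' : δ ≤ δ') (hS : 0 ≤ S)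
    (hT : S ≤ T + 1) : Real.exp (-(δ' / n) * T) ≤ Real.exp δ' * Real.exp (-(δ / n) * S) := by
  rw [← Real.exp_add]
  refine Real.exp_le_exp.mpr ?_
  have hnpos : 0 < n := lt_of_lt_of_le one_pos hn
  have hδ' : 0 ≤ δ' := hδ.trans hδδ'
  have h1 : δ' / n * (S - 1) ≤ δ' / n * T :=
    mul_le_mul_of_nonneg_left (by linarith) (div_nonneg hδ' hnpos.le)
  have h2 : δ / n * S ≤ δ' / n * S :=
    mul_le_mul_of_nonneg_right (div_le_div_of_nonneg_right hδδ' hnpos.le) hS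
  have h3 : δ' / n ≤ δ' := div_le_self hδ' hn
  linarith

/-- INVERSE-POWER WEAKENING: `1/ρ^k ≤ 2^k / S^k` for `S/2 ≤ ρ`, `0 < S`. [folklore] -/
theorem inv_pow_transport {S ρ : ℝ} (hS : 0 < S) (hρ : S / 2 ≤ ρ) (k : ℕ) :
    1 / ρ ^ k ≤ 2 ^ k / S ^ k := by
  have hS2 : 0 < S / 2 := by positivity
  have h1 : (S / 2) ^ k ≤ ρ ^ k := pow_le_pow_left₀ hS2.le hρ k
  calc 1 / ρ ^ k ≤ 1 / (S / 2) ^ k := one_div_le_one_div_of_le (pow_pos hS2 k) h1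
    _ = 2 ^ k / S ^ k := by rw [div_pow, one_div_div]

/-- THE PROFILE TRANSPORT: a supplier bound `val ≤ A η² e^{−(δ′/n) T} / ρ^k` with
`S ≤ T + 1`, `S/2 ≤ ρ`, `δ ≤ δ′` gives `n² val ≤ 2^k e^{δ′} A · e^{−(δ/n) S} / S^k`. [folklore] -/
theorem profile_transport {n : ℕ} (hn : 1 ≤ n) {δ δ' A val T ρ S : ℝ} {k : ℕ} (hδ : 0 ≤ δ)
    (hδδ' : δ ≤ δ') (hA : 0 ≤ A) (hS : 0 < S) (hT : S ≤ T + 1) (hρ : S / 2 ≤ ρ)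
    (h : val ≤ A * (1 / ((n : ℕ) : ℝ)) ^ 2 * Real.exp (-(δ' / ((n : ℕ) : ℝ)) * T) / ρ ^ k) :
    ((n : ℕ) : ℝ) ^ 2 * val ≤
      2 ^ k * Real.exp δ' * A * Real.exp (-(δ / ((n : ℕ) : ℝ)) * S) / S ^ k := by
  have hn' : (1 : ℝ) ≤ ((n : ℕ) : ℝ) := by exact_mod_cast hn
  have hnpos : (0 : ℝ) < ((n : ℕ) : ℝ) := lt_of_lt_of_le one_pos hn'
  have hρpos : 0 < ρ := lt_of_lt_of_le (by positivity) hρ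
  have hE := exp_transport hn' hδ hδδ' hS.le hT
  have hP := inv_pow_transport hS hρ k
  have hsq : ((n : ℕ) : ℝ) ^ 2 * (1 / ((n : ℕ) : ℝ)) ^ 2 = 1 := by
    rw [one_div, inv_pow, mul_inv_cancel₀ (pow_ne_zero 2 hnpos.ne')]
  calc ((n : ℕ) : ℝ) ^ 2 * val
      ≤ ((n : ℕ) : ℝ) ^ 2 *
          (A * (1 / ((n : ℕ) : ℝ)) ^ 2 * Real.exp (-(δ' / ((n : ℕ) : ℝ)) * T) / ρ ^ k) :=
        mul_le_mul_of_nonneg_left h (by positivity)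
    _ = (((n : ℕ) : ℝ) ^ 2 * (1 / ((n : ℕ) : ℝ)) ^ 2) * A *
          Real.exp (-(δ' / ((n : ℕ) : ℝ)) * T) * (1 / ρ ^ k) := by ring
    _ = A * Real.exp (-(δ' / ((n : ℕ) : ℝ)) * T) * (1 / ρ ^ k) := by rw [hsq, one_mul]
    _ ≤ A * (Real.exp δ' * Real.exp (-(δ / ((n : ℕ) : ℝ)) * S)) * (2 ^ k / S ^ k) :=
        mul_le_mul (mul_le_mul_of_nonneg_left hE hA) hP (by positivity) (by positivity)
    _ = _ := by ring

end Transport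

/-! ## §4 The four rows per base point -/

section Rows

variable (n : ℕ) [NeZero n] (M : Fin 4 → ℕ) [hM : ∀ μ, NeZero (M μ)]

/-- **THE FOUR ROWS FROM THE FOUR TORUS-INTRINSIC LEGS, ONE INSTANCE** (the combinatorial core, for
ANY bond-indexed kernel `G` on the fine torus): the value / observation-difference legs (`hL`, the
shape of `VectorTailsLoc.legs_uniform`) and the source-difference / mixed legs (`hD`, the shape of
`VectorTailsDipole.legs_uniform₂`) at rates `δ₁, δ₂ ≥ δ` give the rows `d0 / d1 / d1× / d2×` of the
reading `rdM n M G` at every `v ≠ 0` in the faithful box, with the constants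
`4e^{δ₁}A₀, 8e^{δ₁}A₁, 8e^{δ₂}A₂ + 8e^{δ₁}A₁, 16e^{δ₂}A₃`. [folklore] -/
theorem rows_of_legs (hn : 1 ≤ n)
    (G : Matrix (Tor (fine n M) × Fin 4) (Tor (fine n M) × Fin 4) ℂ) {δ δ₁ δ₂ A₀ A₁ A₂ A₃ : ℝ}
    (hδ : 0 ≤ δ) (l1 : δ ≤ δ₁) (l2 : δ ≤ δ₂) (hA₀ : 0 ≤ A₀) (hA₁ : 0 ≤ A₁) (hA₂ : 0 ≤ A₂)
    (hA₃ : 0 ≤ A₃)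
    (hL : ∀ (x x₀ : Tor (fine n M)) (κ ν₀ : Fin 4),
      ‖G (x, κ) (x₀, ν₀)‖ ≤
          A₀ * (1 / ((n : ℕ) : ℝ)) ^ 2 * Real.exp (-(δ₁ / ((n : ℕ) : ℝ)) * (tdist x₀ x : ℝ)) /
            nrm (liftZ (x - x₀)) ^ 2 ∧
      ∀ μ : Fin 4, ‖G (x + unitVec (fine n M) μ, κ) (x₀, ν₀) - G (x, κ) (x₀, ν₀)‖ ≤
          A₁ * (1 / ((n : ℕ) : ℝ)) ^ 2 * Real.exp (-(δ₁ / ((n : ℕ) : ℝ)) * (tdist x₀ x : ℝ)) /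
            nrm (liftZ (x - x₀)) ^ 3)
    (hD : ∀ (x x₀ : Tor (fine n M)) (κ ν₀ μ : Fin 4),
      ‖G (x, κ) (x₀ + unitVec (fine n M) μ, ν₀) - G (x, κ) (x₀, ν₀)‖ ≤
          A₂ * (1 / ((n : ℕ) : ℝ)) ^ 2 * Real.exp (-(δ₂ / ((n : ℕ) : ℝ)) * (tdist x₀ x : ℝ)) /
            nrm (liftZ (x - x₀)) ^ 3 ∧
      ∀ μ' : Fin 4, ‖(G (x + unitVec (fine n M) μ', κ) (x₀ + unitVec (fine n M) μ, ν₀) -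
            G (x, κ) (x₀ + unitVec (fine n M) μ, ν₀)) -
          (G (x + unitVec (fine n M) μ', κ) (x₀, ν₀) - G (x, κ) (x₀, ν₀))‖ ≤
          A₃ * (1 / ((n : ℕ) : ℝ)) ^ 2 * Real.exp (-(δ₂ / ((n : ℕ) : ℝ)) * (tdist x₀ x : ℝ)) /
            nrm (liftZ (x - x₀)) ^ 4)
    (x₀ : Tor (fine n M)) (κ ν₀ : Fin 4) {φ : ℂ →+ ℝ} (hφ : ∀ z, |φ z| ≤ ‖z‖)
    {v : DyadicShell.Pt} (hv : v ≠ 0) (hbox : InBox (fine n M) v) :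
    |rdM n M G x₀ κ ν₀ φ v| ≤
        2 ^ 2 * Real.exp δ₁ * A₀ * Real.exp (-(δ / ((n : ℕ) : ℝ)) * DyadicShell.supNorm v) /
          (DyadicShell.supNorm v : ℝ) ^ 2 ∧
    (∀ ρ : Fin 4, |rdM n M G x₀ κ ν₀ φ (v + BubbleTransfer.unitVec ρ) - rdM n M G x₀ κ ν₀ φ v| ≤
        2 ^ 3 * Real.exp δ₁ * A₁ * Real.exp (-(δ / ((n : ℕ) : ℝ)) * DyadicShell.supNorm v) /
          (DyadicShell.supNorm v : ℝ) ^ 3) ∧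
    (∀ μ : Fin 4, |rdM n M G (x₀ + unitVec (fine n M) μ) κ ν₀ φ v - rdM n M G x₀ κ ν₀ φ v| ≤
        (2 ^ 3 * Real.exp δ₂ * A₂ + 2 ^ 3 * Real.exp δ₁ * A₁) *
            Real.exp (-(δ / ((n : ℕ) : ℝ)) * DyadicShell.supNorm v) /
          (DyadicShell.supNorm v : ℝ) ^ 3) ∧
    (∀ μ ν : Fin 4,
      |rdM n M G x₀ κ ν₀ φ (v + BubbleTransfer.unitVec μ + BubbleTransfer.unitVec ν) -
          rdM n M G x₀ κ ν₀ φ (v + BubbleTransfer.unitVec μ) -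
          (rdM n M G (x₀ + unitVec (fine n M) μ) κ ν₀ φ (v + BubbleTransfer.unitVec ν) -
            rdM n M G (x₀ + unitVec (fine n M) μ) κ ν₀ φ v)| ≤
        2 ^ 4 * Real.exp δ₂ * A₃ * Real.exp (-(δ / ((n : ℕ) : ℝ)) * DyadicShell.supNorm v) /
          (DyadicShell.supNorm v : ℝ) ^ 4) := by
  have hS1 : (1 : ℝ) ≤ (DyadicShell.supNorm v : ℝ) := one_le_supNorm_of_ne_zero hv
  have hS : (0 : ℝ) < (DyadicShell.supNorm v : ℝ) := lt_of_lt_of_le one_pos hS1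
  -- the dictionary at `v` and at `v + e_μ`
  have hsv : supNorm v ≤ supNorm v + 1 := Nat.le_succ _
  have hsvμ : ∀ μ : Fin 4, supNorm (v + BubbleTransfer.unitVec μ) ≤ supNorm v + 1 :=
    fun μ => supNorm_add_single_le v μ
  have tdv : (tdist x₀ (x₀ + castT (fine n M) v) : ℝ) = (DyadicShell.supNorm v : ℝ) := by
    rw [tdist_add_castT_of_inBox x₀ hbox hsv]; rfl
  have lfv : liftZ (x₀ + castT (fine n M) v - x₀) = v :=
    liftZ_add_castT_sub_of_inBox x₀ hbox hsv
  have nrv : nrm v = (DyadicShell.supNorm v : ℝ) := nrm_eq_supNorm_of_ne_zero hv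
  have tdvμ : ∀ μ : Fin 4, (DyadicShell.supNorm v : ℝ) ≤
      (tdist x₀ (x₀ + castT (fine n M) (v + BubbleTransfer.unitVec μ)) : ℝ) + 1 := fun μ => by
    rw [tdist_add_castT_of_inBox x₀ hbox (hsvμ μ)]
    have h1 : DyadicShell.supNorm v ≤ supNorm (v + BubbleTransfer.unitVec μ) + 1 :=
      supNorm_le_add_single v μ
    exact_mod_cast h1
  have lfvμ : ∀ μ : Fin 4, liftZ (x₀ + castT (fine n M) (v + BubbleTransfer.unitVec μ) - x₀) =
      v + BubbleTransfer.unitVec μ := fun μ => liftZ_add_castT_sub_of_inBox x₀ hbox (hsvμ μ)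
  have nrvμ : ∀ μ : Fin 4, (DyadicShell.supNorm v : ℝ) / 2 ≤ nrm (v + BubbleTransfer.unitVec μ) :=
    fun μ => by
    have h := nrm_shift_ge_half v (BubbleTransfer.unitVec μ) (supNorm_single_one μ)
    rwa [nrv] at h
  -- the observation points, two ways
  have xeq : ∀ ρ : Fin 4, x₀ + castT (fine n M) (v + BubbleTransfer.unitVec ρ) =
      x₀ + castT (fine n M) v + unitVec (fine n M) ρ := fun ρ => by
    rw [castT_add_unitVec (fine n M) v ρ, add_assoc]
  have xeq' : ∀ μ : Fin 4, x₀ + unitVec (fine n M) μ + castT (fine n M) v =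
      x₀ + castT (fine n M) (v + BubbleTransfer.unitVec μ) := fun μ => by
    rw [xeq μ, add_right_comm]
  have xeq2 : ∀ μ ν : Fin 4,
      x₀ + castT (fine n M) (v + BubbleTransfer.unitVec μ + BubbleTransfer.unitVec ν) =
        x₀ + castT (fine n M) (v + BubbleTransfer.unitVec μ) + unitVec (fine n M) ν := fun μ ν => by
    rw [castT_add_unitVec (fine n M) (v + BubbleTransfer.unitVec μ) ν, add_assoc]
  have xeq2' : ∀ μ ν : Fin 4,
      x₀ + unitVec (fine n M) μ + castT (fine n M) (v + BubbleTransfer.unitVec ν) =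
        x₀ + castT (fine n M) (v + BubbleTransfer.unitVec μ) + unitVec (fine n M) ν := fun μ ν => by
    rw [castT_add_unitVec (fine n M) v ν, ← add_assoc, xeq' μ]
  refine ⟨?_, fun ρ => ?_, fun μ => ?_, fun μ ν => ?_⟩
  · -- d0: the value leg at `x = x₀ + castT v`
    have h := (hL (x₀ + castT (fine n M) v) x₀ κ ν₀).1
    rw [lfv, nrv, tdv] at h
    exact (abs_sq_mul_le n hφ _).trans
      (profile_transport (k := 2) hn hδ l1 hA₀ hS (by linarith) (by linarith) h)
  · -- d1: the observation-difference leg at `x = x₀ + castT v`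
    have h := (hL (x₀ + castT (fine n M) v) x₀ κ ν₀).2 ρ
    rw [lfv, nrv, tdv] at h
    have e1 : rdM n M G x₀ κ ν₀ φ (v + BubbleTransfer.unitVec ρ) - rdM n M G x₀ κ ν₀ φ v =
        ((n : ℕ) : ℝ) ^ 2 * φ (G (x₀ + castT (fine n M) v + unitVec (fine n M) ρ, κ) (x₀, ν₀) -
          G (x₀ + castT (fine n M) v, κ) (x₀, ν₀)) := by
      rw [rdM, rdM, xeq ρ, map_sub]; ring
    rw [e1]
    exact (abs_sq_mul_le n hφ _).trans
      (profile_transport (k := 3) hn hδ l1 hA₁ hS (by linarith) (by linarith) h)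
  · -- d1× = (source-bond difference at `x = x₀ + castT v + e_μ`) + (observation difference at `x₀ + castT v`)
    have hsrc := (hD (x₀ + castT (fine n M) (v + BubbleTransfer.unitVec μ)) x₀ κ ν₀ μ).1
    rw [lfvμ μ] at hsrc
    have hobs := (hL (x₀ + castT (fine n M) v) x₀ κ ν₀).2 μ
    rw [lfv, nrv, tdv] at hobs
    have e1 : rdM n M G (x₀ + unitVec (fine n M) μ) κ ν₀ φ v - rdM n M G x₀ κ ν₀ φ v =
        ((n : ℕ) : ℝ) ^ 2 * φ
            (G (x₀ + castT (fine n M) (v + BubbleTransfer.unitVec μ), κ) (x₀ + unitVec (fine n M) μ, ν₀) -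
              G (x₀ + castT (fine n M) (v + BubbleTransfer.unitVec μ), κ) (x₀, ν₀)) +
          ((n : ℕ) : ℝ) ^ 2 * φ
            (G (x₀ + castT (fine n M) v + unitVec (fine n M) μ, κ) (x₀, ν₀) -
              G (x₀ + castT (fine n M) v, κ) (x₀, ν₀)) := by
      rw [rdM, rdM, xeq' μ, map_sub, map_sub, xeq μ]; ring
    rw [e1]
    refine (abs_add_le _ _).trans ?_
    have t1 := (abs_sq_mul_le n hφ _).trans
      (profile_transport (k := 3) hn hδ l2 hA₂ hS (tdvμ μ) (nrvμ μ) hsrc)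
    have t2 := (abs_sq_mul_le n hφ _).trans
      (profile_transport (k := 3) hn hδ l1 hA₁ hS (by linarith) (by linarith) hobs)
    refine (add_le_add t1 t2).trans (le_of_eq ?_)
    ring
  · -- d2× = minus the mixed difference at `x = x₀ + castT v + e_μ`, `μ' = ν`
    have hmix := (hD (x₀ + castT (fine n M) (v + BubbleTransfer.unitVec μ)) x₀ κ ν₀ μ).2 ν
    rw [lfvμ μ] at hmix
    have e1 : rdM n M G x₀ κ ν₀ φ (v + BubbleTransfer.unitVec μ + BubbleTransfer.unitVec ν) -
          rdM n M G x₀ κ ν₀ φ (v + BubbleTransfer.unitVec μ) -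
          (rdM n M G (x₀ + unitVec (fine n M) μ) κ ν₀ φ (v + BubbleTransfer.unitVec ν) -
            rdM n M G (x₀ + unitVec (fine n M) μ) κ ν₀ φ v) =
        -(((n : ℕ) : ℝ) ^ 2 * φ
          ((G (x₀ + castT (fine n M) (v + BubbleTransfer.unitVec μ) + unitVec (fine n M) ν, κ)
                (x₀ + unitVec (fine n M) μ, ν₀) -
              G (x₀ + castT (fine n M) (v + BubbleTransfer.unitVec μ), κ)
                (x₀ + unitVec (fine n M) μ, ν₀)) -
            (G (x₀ + castT (fine n M) (v + BubbleTransfer.unitVec μ) + unitVec (fine n M) ν, κ)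
                (x₀, ν₀) -
              G (x₀ + castT (fine n M) (v + BubbleTransfer.unitVec μ), κ) (x₀, ν₀)))) := by
      rw [rdM, rdM, rdM, rdM, xeq2 μ ν, xeq2' μ ν, xeq' μ, map_sub, map_sub, map_sub]; ring
    rw [e1, abs_neg]
    exact (abs_sq_mul_le n hφ _).trans
      (profile_transport (k := 4) hn hδ l2 hA₃ hS (tdvμ μ) (nrvμ μ) hmix)

end Rows

/-! ## §5 The four rows for `𝒢`, uniformly in the instance -/

section Legs

variable {ι : Type} (nOf : ι → ℕ) [hn0 : ∀ i, NeZero (nOf i)] (hn1 : ∀ i, 1 ≤ nOf i)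
  (MOf : ι → Fin 4 → ℕ) [hM0 : ∀ i μ, NeZero (MOf i μ)] (a : ℝ) (ha : 0 < a)

/-- **THE FOUR DECAY ROWS `d0 / d1 / d1× / d2×` PER BASE POINT, IN THE WALL'S ATOMS, UNIFORMLY IN
THE INSTANCE.**  ASSUMING [B5, (1.110)–(1.114)] for the reading `fam` and [B5, (1.126)–(1.127)]
for the reading `kfam` BY NAME: there are `δ > 0` and `A₀, A₁, A₂, A₃ ≥ 0` such that for EVERY
instance `i` (scale `n = nOf i` and volume `MOf i`), every base bond `(x₀, ν₀)` and component `κ`,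
every real reading `φ` with `|φ z| ≤ ‖z‖`, and every `v ≠ 0` in the faithful box of the torus, the
reading `G = rd n … x₀ κ ν₀ φ` and its base-point shift `G′ = rd n … (x₀ + e_μ) κ ν₀ φ` obey
`|G v| ≤ A₀ e^{−(δ/n)‖v‖}/‖v‖²`, `|G(v+e_ρ) − G v| ≤ A₁ e^{…}/‖v‖³`, `|G′ v − G v| ≤ A₃ e^{…}/‖v‖³`,
`|G(v+e_μ+e_ν) − G(v+e_μ) − (G′(v+e_ν) − G′ v)| ≤ A₂ e^{…}/‖v‖⁴`. [folklore] -/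
theorem legs_pt (h12 : B5.Prop12Printed (fam nOf hn1 MOf a ha))
    (h126 : B5.Kernel126_127Printed (kfam nOf MOf)) :
    ∃ δ A₀ A₁ A₂ A₃ : ℝ, 0 < δ ∧ 0 ≤ A₀ ∧ 0 ≤ A₁ ∧ 0 ≤ A₂ ∧ 0 ≤ A₃ ∧
      ∀ (i : ι) (x₀ : Tor (fine (nOf i) (MOf i))) (κ ν₀ : Fin 4) (φ : ℂ →+ ℝ),
        (∀ z, |φ z| ≤ ‖z‖) → ∀ v : DyadicShell.Pt, v ≠ 0 → InBox (fine (nOf i) (MOf i)) v →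
        |rd (nOf i) (hn1 i) (MOf i) a ha x₀ κ ν₀ φ v| ≤
            A₀ * Real.exp (-(δ / (nOf i : ℕ)) * DyadicShell.supNorm v) /
              (DyadicShell.supNorm v : ℝ) ^ 2 ∧
        (∀ ρ : Fin 4,
          |rd (nOf i) (hn1 i) (MOf i) a ha x₀ κ ν₀ φ (v + BubbleTransfer.unitVec ρ) -
              rd (nOf i) (hn1 i) (MOf i) a ha x₀ κ ν₀ φ v| ≤
            A₁ * Real.exp (-(δ / (nOf i : ℕ)) * DyadicShell.supNorm v) /
              (DyadicShell.supNorm v : ℝ) ^ 3) ∧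
        (∀ μ : Fin 4,
          |rd (nOf i) (hn1 i) (MOf i) a ha (x₀ + unitVec (fine (nOf i) (MOf i)) μ) κ ν₀ φ v -
              rd (nOf i) (hn1 i) (MOf i) a ha x₀ κ ν₀ φ v| ≤
            A₃ * Real.exp (-(δ / (nOf i : ℕ)) * DyadicShell.supNorm v) /
              (DyadicShell.supNorm v : ℝ) ^ 3) ∧
        (∀ μ ν : Fin 4,
          |rd (nOf i) (hn1 i) (MOf i) a ha x₀ κ ν₀ φ
                (v + BubbleTransfer.unitVec μ + BubbleTransfer.unitVec ν) -
              rd (nOf i) (hn1 i) (MOf i) a ha x₀ κ ν₀ φ (v + BubbleTransfer.unitVec μ) -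
              (rd (nOf i) (hn1 i) (MOf i) a ha (x₀ + unitVec (fine (nOf i) (MOf i)) μ) κ ν₀ φ
                  (v + BubbleTransfer.unitVec ν) -
                rd (nOf i) (hn1 i) (MOf i) a ha (x₀ + unitVec (fine (nOf i) (MOf i)) μ) κ ν₀ φ
                  v)| ≤
            A₂ * Real.exp (-(δ / (nOf i : ℕ)) * DyadicShell.supNorm v) /
              (DyadicShell.supNorm v : ℝ) ^ 4) := by
  obtain ⟨δ₁, A₀, A₁, hδ₁, hA₀, hA₁, hL⟩ := legs_uniform nOf hn1 MOf a ha (by norm_num) h12 h126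
  obtain ⟨δ₂, A₂, A₃, hδ₂, hA₂, hA₃, hD⟩ := legs_uniform₂ nOf hn1 MOf a ha (by norm_num) h12 h126
  have hδ : 0 < min δ₁ δ₂ := lt_min hδ₁ hδ₂
  refine ⟨min δ₁ δ₂, 2 ^ 2 * Real.exp δ₁ * A₀, 2 ^ 3 * Real.exp δ₁ * A₁,
    2 ^ 4 * Real.exp δ₂ * A₃, 2 ^ 3 * Real.exp δ₂ * A₂ + 2 ^ 3 * Real.exp δ₁ * A₁, hδ,
    by positivity, by positivity, by positivity, by positivity,
    fun i x₀ κ ν₀ φ hφ v hv hbox => ?_⟩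
  have hL' := hL i
  have hD' := hD i
  simp only [Nat.reduceSub] at hL' hD'
  exact rows_of_legs (nOf i) (MOf i) (hn1 i) (calG (nOf i) (hn1 i) (MOf i) a ha) hδ.le
    (min_le_left _ _) (min_le_right _ _) hA₀ hA₁ hA₂ hA₃ hL' hD' x₀ κ ν₀ hφ hv hbox

/-- the constants of `legs_pt` as ONE function `A : ℕ → ℝ`, `0 ≤ A j`, in the wall's numbering:
`A 0` (d0), `A 1` (d1), `A 3` (d1×), `A 2` (d2×). [folklore] -/
theorem legs_pt_A (h12 : B5.Prop12Printed (fam nOf hn1 MOf a ha))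
    (h126 : B5.Kernel126_127Printed (kfam nOf MOf)) :
    ∃ (δ : ℝ) (A : ℕ → ℝ), 0 < δ ∧ (∀ j, 0 ≤ A j) ∧
      ∀ (i : ι) (x₀ : Tor (fine (nOf i) (MOf i))) (κ ν₀ : Fin 4) (φ : ℂ →+ ℝ),
        (∀ z, |φ z| ≤ ‖z‖) → ∀ v : DyadicShell.Pt, v ≠ 0 → InBox (fine (nOf i) (MOf i)) v →
        |rd (nOf i) (hn1 i) (MOf i) a ha x₀ κ ν₀ φ v| ≤
            A 0 * Real.exp (-(δ / (nOf i : ℕ)) * DyadicShell.supNorm v) /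
              (DyadicShell.supNorm v : ℝ) ^ 2 ∧
        (∀ ρ : Fin 4,
          |rd (nOf i) (hn1 i) (MOf i) a ha x₀ κ ν₀ φ (v + BubbleTransfer.unitVec ρ) -
              rd (nOf i) (hn1 i) (MOf i) a ha x₀ κ ν₀ φ v| ≤
            A 1 * Real.exp (-(δ / (nOf i : ℕ)) * DyadicShell.supNorm v) /
              (DyadicShell.supNorm v : ℝ) ^ 3) ∧
        (∀ μ : Fin 4,
          |rd (nOf i) (hn1 i) (MOf i) a ha (x₀ + unitVec (fine (nOf i) (MOf i)) μ) κ ν₀ φ v -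
              rd (nOf i) (hn1 i) (MOf i) a ha x₀ κ ν₀ φ v| ≤
            A 3 * Real.exp (-(δ / (nOf i : ℕ)) * DyadicShell.supNorm v) /
              (DyadicShell.supNorm v : ℝ) ^ 3) ∧
        (∀ μ ν : Fin 4,
          |rd (nOf i) (hn1 i) (MOf i) a ha x₀ κ ν₀ φ
                (v + BubbleTransfer.unitVec μ + BubbleTransfer.unitVec ν) -
              rd (nOf i) (hn1 i) (MOf i) a ha x₀ κ ν₀ φ (v + BubbleTransfer.unitVec μ) -
              (rd (nOf i) (hn1 i) (MOf i) a ha (x₀ + unitVec (fine (nOf i) (MOf i)) μ) κ ν₀ φ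
                  (v + BubbleTransfer.unitVec ν) -
                rd (nOf i) (hn1 i) (MOf i) a ha (x₀ + unitVec (fine (nOf i) (MOf i)) μ) κ ν₀ φ
                  v)| ≤
            A 2 * Real.exp (-(δ / (nOf i : ℕ)) * DyadicShell.supNorm v) /
              (DyadicShell.supNorm v : ℝ) ^ 4) := by
  obtain ⟨δ, A₀, A₁, A₂, A₃, hδ, hA₀, hA₁, hA₂, hA₃, h⟩ := legs_pt nOf hn1 MOf a ha h12 h126
  refine ⟨δ, fun j => if j = 0 then A₀ else if j = 1 then A₁ else if j = 2 then A₂ else A₃, hδ,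
    fun j => ?_, fun i x₀ κ ν₀ φ hφ v hv hbox => ?_⟩
  · dsimp only; split_ifs <;> assumption
  · exact h i x₀ κ ν₀ φ hφ v hv hbox

end Legs

/-! ## §6 The volume form: every fixed point is eventually in the faithful box -/

section Volume

variable {ι : Type} (nOf : ι → ℕ) [hn0 : ∀ i, NeZero (nOf i)] (hn1 : ∀ i, 1 ≤ nOf i)
  (MOf : ι → Fin 4 → ℕ) [hM0 : ∀ i μ, NeZero (MOf i μ)] (a : ℝ) (ha : 0 < a)

omit hn0 hM0 in
/-- if the sides of the tori tend to infinity along a filter of volumes, every fixed lattice point is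
eventually in the faithful box ((R13-1) «T ↗ ℤ⁴ first»). [folklore] -/
theorem eventually_inBox {τ : Type*} {l : Filter τ} (vol : τ → ι)
    (hgrow : ∀ μ : Fin 4, Tendsto (fun t => nOf (vol t) * MOf (vol t) μ) l atTop)
    (v : DyadicShell.Pt) : ∀ᶠ t in l, InBox (fine (nOf (vol t)) (MOf (vol t))) v := by
  have h : ∀ μ : Fin 4, ∀ᶠ t in l, 2 * (supNorm v + 1) < nOf (vol t) * MOf (vol t) μ :=
    fun μ => (hgrow μ).eventually (eventually_gt_atTop _)
  exact (eventually_all.mpr h).mono fun t ht μ => ht μ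

/-- **THE FOUR ROWS, EVENTUALLY IN THE VOLUME.**  For any volume parametrisation `t ↦ vol t` of
the family along which the sides `n M_μ` tend to infinity, any base bonds `t ↦ (x₀ t, ν₀)`,
component `κ` and real reading `φ` (`|φ z| ≤ ‖z‖`): the rows `d0 / d1 / d1× / d2×` hold
`∀ᶠ t in l` at every `v ≠ 0`, with the constants of `legs_pt` (chosen before everything).  These
are the torus-side hypotheses of the volume seam read through the instantiator's own dictionary.
[folklore] -/
theorem legs_pt_eventually (h12 : B5.Prop12Printed (fam nOf hn1 MOf a ha))
    (h126 : B5.Kernel126_127Printed (kfam nOf MOf)) :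
    ∃ δ A₀ A₁ A₂ A₃ : ℝ, 0 < δ ∧ 0 ≤ A₀ ∧ 0 ≤ A₁ ∧ 0 ≤ A₂ ∧ 0 ≤ A₃ ∧
      ∀ {τ : Type} {l : Filter τ} (vol : τ → ι),
        (∀ μ : Fin 4, Tendsto (fun t => nOf (vol t) * MOf (vol t) μ) l atTop) →
        ∀ (x₀ : (t : τ) → Tor (fine (nOf (vol t)) (MOf (vol t)))) (κ ν₀ : Fin 4) (φ : ℂ →+ ℝ),
        (∀ z, |φ z| ≤ ‖z‖) → ∀ v : DyadicShell.Pt, v ≠ 0 →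
        (∀ᶠ t in l, |rd (nOf (vol t)) (hn1 (vol t)) (MOf (vol t)) a ha (x₀ t) κ ν₀ φ v| ≤
            A₀ * Real.exp (-(δ / (nOf (vol t) : ℕ)) * DyadicShell.supNorm v) /
              (DyadicShell.supNorm v : ℝ) ^ 2) ∧
        (∀ ρ : Fin 4, ∀ᶠ t in l,
          |rd (nOf (vol t)) (hn1 (vol t)) (MOf (vol t)) a ha (x₀ t) κ ν₀ φ
                (v + BubbleTransfer.unitVec ρ) -
              rd (nOf (vol t)) (hn1 (vol t)) (MOf (vol t)) a ha (x₀ t) κ ν₀ φ v| ≤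
            A₁ * Real.exp (-(δ / (nOf (vol t) : ℕ)) * DyadicShell.supNorm v) /
              (DyadicShell.supNorm v : ℝ) ^ 3) ∧
        (∀ μ : Fin 4, ∀ᶠ t in l,
          |rd (nOf (vol t)) (hn1 (vol t)) (MOf (vol t)) a ha
                (x₀ t + unitVec (fine (nOf (vol t)) (MOf (vol t))) μ) κ ν₀ φ v -
              rd (nOf (vol t)) (hn1 (vol t)) (MOf (vol t)) a ha (x₀ t) κ ν₀ φ v| ≤
            A₃ * Real.exp (-(δ / (nOf (vol t) : ℕ)) * DyadicShell.supNorm v) /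
              (DyadicShell.supNorm v : ℝ) ^ 3) ∧
        (∀ μ ν : Fin 4, ∀ᶠ t in l,
          |rd (nOf (vol t)) (hn1 (vol t)) (MOf (vol t)) a ha (x₀ t) κ ν₀ φ
                (v + BubbleTransfer.unitVec μ + BubbleTransfer.unitVec ν) -
              rd (nOf (vol t)) (hn1 (vol t)) (MOf (vol t)) a ha (x₀ t) κ ν₀ φ
                (v + BubbleTransfer.unitVec μ) -
              (rd (nOf (vol t)) (hn1 (vol t)) (MOf (vol t)) a ha
                  (x₀ t + unitVec (fine (nOf (vol t)) (MOf (vol t))) μ) κ ν₀ φ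
                  (v + BubbleTransfer.unitVec ν) -
                rd (nOf (vol t)) (hn1 (vol t)) (MOf (vol t)) a ha
                  (x₀ t + unitVec (fine (nOf (vol t)) (MOf (vol t))) μ) κ ν₀ φ v)| ≤
            A₂ * Real.exp (-(δ / (nOf (vol t) : ℕ)) * DyadicShell.supNorm v) /
              (DyadicShell.supNorm v : ℝ) ^ 4) := by
  obtain ⟨δ, A₀, A₁, A₂, A₃, hδ, hA₀, hA₁, hA₂, hA₃, h⟩ := legs_pt nOf hn1 MOf a ha h12 h126
  refine ⟨δ, A₀, A₁, A₂, A₃, hδ, hA₀, hA₁, hA₂, hA₃,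
    fun vol hgrow x₀ κ ν₀ φ hφ v hv => ⟨?_, fun ρ => ?_, fun μ => ?_, fun μ ν => ?_⟩⟩
  all_goals
    filter_upwards [eventually_inBox nOf MOf vol hgrow v] with t ht
  · exact (h (vol t) (x₀ t) κ ν₀ φ hφ v hv ht).1
  · exact (h (vol t) (x₀ t) κ ν₀ φ hφ v hv ht).2.1 ρ
  · exact (h (vol t) (x₀ t) κ ν₀ φ hφ v hv ht).2.2.1 μ
  · exact (h (vol t) (x₀ t) κ ν₀ φ hφ v hv ht).2.2.2 μ ν

end Volume

/-! ## §7 The wall form: the torus-side rows `d0T / d1T / d1×T / d2×T` of the volume seam, literally -/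

section Wall

variable {τ : Type} {κB : Type*} (Mv : ℕ+ × τ → Fin 4 → ℕ) [hMv : ∀ i ρ, NeZero (Mv i ρ)]
  (a : ℝ) (ha : 0 < a)

/-- THE WALL'S TORUS-SIDE KERNEL FAMILY READ OFF `𝒢`.  The family index is `(n, t)`: scale
`n ≥ 1` (as `ℕ+`) and volume `t : τ`, the torus being `Π_μ ℤ/(n · Mv (n,t) μ)`; an instance map of
the wall is: base points `b : κB ↦ X₀ (n,t) b` (the source site), `kk n b` (observed component),
`nn n b` (source bond direction), and a real reading `φ`.  Then
`GT n b t v = n² φ (𝒢_{(n,t)} ((X₀ b + castT v, kk b), (X₀ b, nn b)))` for `n ≥ 1` (and `0` at the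
unused scale `n = 0`), in the binder shape `GT : ℕ → κB → τ → Pt → ℝ` of the volume seam (the
scale is passed to `rd` as `PNat.val ⟨n, _⟩ ≡ n`, so that `NeZero` is found by `NeZero.pnat`).
[folklore] -/
def GT (X₀ : (i : ℕ+ × τ) → κB → Tor (fine ((i.1 : ℕ+) : ℕ) (Mv i))) (kk nn : ℕ → κB → Fin 4)
    (φ : ℂ →+ ℝ) (n : ℕ) (b : κB) (t : τ) (v : DyadicShell.Pt) : ℝ :=
  if h : 0 < n then
    rd (PNat.val ⟨n, h⟩) (PNat.pos _) (Mv (⟨n, h⟩, t)) a ha (X₀ (⟨n, h⟩, t) b) (kk n b) (nn n b)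
      φ v
  else 0

/-- `GT` at a positive scale is the reading `rd` at the instance `(n, t)`. [folklore] -/
theorem GT_pos (X₀ : (i : ℕ+ × τ) → κB → Tor (fine ((i.1 : ℕ+) : ℕ) (Mv i)))
    (kk nn : ℕ → κB → Fin 4) (φ : ℂ →+ ℝ) {n : ℕ} (h : 0 < n) (b : κB) (t : τ)
    (v : DyadicShell.Pt) :
    GT Mv a ha X₀ kk nn φ n b t v =
      rd (PNat.val ⟨n, h⟩) (PNat.pos _) (Mv (⟨n, h⟩, t)) a ha (X₀ (⟨n, h⟩, t) b) (kk n b)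
        (nn n b) φ v :=
  dif_pos h

/-- **THE TORUS-SIDE ROWS OF THE VOLUME SEAM, LITERALLY.**  ASSUMING [B5, (1.110)–(1.114)] and
[B5, (1.126)–(1.127)] BY NAME for the family `(n, t) ↦ (n, Mv (n, t))`, and that along the filter
`l` of volumes every side `n · Mv (n,t) μ` tends to infinity: for ANY instance map
`(X₀, kk, nn, φ)` (`|φ z| ≤ ‖z‖`), any base-point sets `Bset n` and any relabelling `sh n` of base
points which, on `Bset n`, TRANSLATES THE SOURCE SITE BY `e_μ` and keeps the component and the bond
direction, there are `δ > 0` and `A : ℕ → ℝ≥0` (chosen first) with the four hypotheses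
`d0T / d1T / d1×T / d2×T` of the volume seam for `GT = VectorTailsPt.GT Mv a ha X₀ kk nn φ`:
`∀ n ≥ 2, ∀ b ∈ Bset n, ∀ v ≠ 0, ∀ᶠ t in l, |GT n b t v| ≤ A 0 e^{−(δ/n)‖v‖}/‖v‖²`, the first
difference with `A 1 /‖v‖³`, the cross difference `GT n (sh n b) t v − GT n b t v` with `A 3 /‖v‖³`,
and the cross mixed second difference with `A 2 /‖v‖⁴`.  (The infinite-volume limits `hG` of the
seam and the rows `h0T…h2×T` are not this file's.) [folklore] -/
theorem wall_rows
    (h12 : B5.Prop12Printed (fam (fun i : ℕ+ × τ => ((i.1 : ℕ+) : ℕ)) (fun i => i.1.pos) Mv a ha))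
    (h126 : B5.Kernel126_127Printed (kfam (fun i : ℕ+ × τ => ((i.1 : ℕ+) : ℕ)) Mv))
    {l : Filter τ} (hgrow : ∀ (m : ℕ+) (ρ : Fin 4), Tendsto (fun t => (m : ℕ) * Mv (m, t) ρ) l atTop)
    (X₀ : (i : ℕ+ × τ) → κB → Tor (fine ((i.1 : ℕ+) : ℕ) (Mv i))) (kk nn : ℕ → κB → Fin 4)
    (φ : ℂ →+ ℝ) (hφ : ∀ z, |φ z| ≤ ‖z‖) (Bset : ℕ → Finset κB) (sh : ℕ → Equiv.Perm κB)
    {μ ν : Fin 4}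
    (hX : ∀ (m : ℕ+) (t : τ), ∀ b ∈ Bset m,
      X₀ (m, t) (sh m b) = X₀ (m, t) b + unitVec (fine (m : ℕ) (Mv (m, t))) μ)
    (hk : ∀ m : ℕ, ∀ b ∈ Bset m, kk m (sh m b) = kk m b)
    (hν : ∀ m : ℕ, ∀ b ∈ Bset m, nn m (sh m b) = nn m b) :
    ∃ (δ : ℝ) (A : ℕ → ℝ), 0 < δ ∧ (∀ j, 0 ≤ A j) ∧
      (∀ n : ℕ, 2 ≤ n → ∀ b ∈ Bset n, ∀ v : DyadicShell.Pt, v ≠ 0 → ∀ᶠ t in l,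
        |GT Mv a ha X₀ kk nn φ n b t v| ≤
          A 0 * Real.exp (-(δ / n) * DyadicShell.supNorm v) / (DyadicShell.supNorm v : ℝ) ^ 2) ∧
      (∀ n : ℕ, 2 ≤ n → ∀ b ∈ Bset n, ∀ v : DyadicShell.Pt, v ≠ 0 → ∀ ρ : Fin 4, ∀ᶠ t in l,
        |GT Mv a ha X₀ kk nn φ n b t (v + BubbleTransfer.unitVec ρ) - GT Mv a ha X₀ kk nn φ n b t v| ≤
          A 1 * Real.exp (-(δ / n) * DyadicShell.supNorm v) / (DyadicShell.supNorm v : ℝ) ^ 3) ∧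
      (∀ n : ℕ, 2 ≤ n → ∀ b ∈ Bset n, ∀ v : DyadicShell.Pt, v ≠ 0 → ∀ᶠ t in l,
        |GT Mv a ha X₀ kk nn φ n (sh n b) t v - GT Mv a ha X₀ kk nn φ n b t v| ≤
          A 3 * Real.exp (-(δ / n) * DyadicShell.supNorm v) / (DyadicShell.supNorm v : ℝ) ^ 3) ∧
      (∀ n : ℕ, 2 ≤ n → ∀ b ∈ Bset n, ∀ v : DyadicShell.Pt, v ≠ 0 → ∀ᶠ t in l,
        |GT Mv a ha X₀ kk nn φ n b t (v + BubbleTransfer.unitVec μ + BubbleTransfer.unitVec ν) -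
            GT Mv a ha X₀ kk nn φ n b t (v + BubbleTransfer.unitVec μ) -
            (GT Mv a ha X₀ kk nn φ n (sh n b) t (v + BubbleTransfer.unitVec ν) -
              GT Mv a ha X₀ kk nn φ n (sh n b) t v)| ≤
          A 2 * Real.exp (-(δ / n) * DyadicShell.supNorm v) / (DyadicShell.supNorm v : ℝ) ^ 4) := by
  obtain ⟨δ, A, hδ, hA, h⟩ :=
    legs_pt_A (fun i : ℕ+ × τ => ((i.1 : ℕ+) : ℕ)) (fun i => i.1.pos) Mv a ha h12 h126
  -- every fixed `v` is eventually in the faithful box of the instance `(n, t)`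
  have box : ∀ (n : ℕ) (h0 : 0 < n) (v : DyadicShell.Pt),
      ∀ᶠ t in l, InBox (fine (PNat.val ⟨n, h0⟩) (Mv (⟨n, h0⟩, t))) v := fun n h0 v =>
    eventually_inBox (fun i : ℕ+ × τ => ((i.1 : ℕ+) : ℕ)) Mv (fun t => ((⟨n, h0⟩ : ℕ+), t))
      (hgrow ⟨n, h0⟩) v
  refine ⟨δ, A, hδ, hA, ?_, ?_, ?_, ?_⟩
  · intro n hn b hb v hv
    have h0 : 0 < n := by omega
    filter_upwards [box n h0 v] with t ht
    rw [GT_pos Mv a ha X₀ kk nn φ h0]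
    exact (h (⟨n, h0⟩, t) (X₀ _ b) (kk n b) (nn n b) φ hφ v hv ht).1
  · intro n hn b hb v hv ρ
    have h0 : 0 < n := by omega
    filter_upwards [box n h0 v] with t ht
    rw [GT_pos Mv a ha X₀ kk nn φ h0, GT_pos Mv a ha X₀ kk nn φ h0]
    exact (h (⟨n, h0⟩, t) (X₀ _ b) (kk n b) (nn n b) φ hφ v hv ht).2.1 ρ
  · intro n hn b hb v hv
    have h0 : 0 < n := by omega
    filter_upwards [box n h0 v] with t ht
    have hX' : X₀ (⟨n, h0⟩, t) (sh n b) =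
        X₀ (⟨n, h0⟩, t) b + unitVec (fine (PNat.val ⟨n, h0⟩) (Mv (⟨n, h0⟩, t))) μ :=
      hX ⟨n, h0⟩ t b hb
    have hk' : kk n (sh n b) = kk n b := hk n b hb
    have hν' : nn n (sh n b) = nn n b := hν n b hb
    rw [GT_pos Mv a ha X₀ kk nn φ h0, GT_pos Mv a ha X₀ kk nn φ h0, hX', hk', hν']
    exact (h (⟨n, h0⟩, t) (X₀ _ b) (kk n b) (nn n b) φ hφ v hv ht).2.2.1 μ
  · intro n hn b hb v hv
    have h0 : 0 < n := by omega
    filter_upwards [box n h0 v] with t ht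
    have hX' : X₀ (⟨n, h0⟩, t) (sh n b) =
        X₀ (⟨n, h0⟩, t) b + unitVec (fine (PNat.val ⟨n, h0⟩) (Mv (⟨n, h0⟩, t))) μ :=
      hX ⟨n, h0⟩ t b hb
    have hk' : kk n (sh n b) = kk n b := hk n b hb
    have hν' : nn n (sh n b) = nn n b := hν n b hb
    rw [GT_pos Mv a ha X₀ kk nn φ h0, GT_pos Mv a ha X₀ kk nn φ h0, GT_pos Mv a ha X₀ kk nn φ h0,
      GT_pos Mv a ha X₀ kk nn φ h0, hX', hk', hν']
    exact (h (⟨n, h0⟩, t) (X₀ _ b) (kk n b) (nn n b) φ hφ v hv ht).2.2.2 μ ν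

end Wall

/-! ## §8 Block-translation covariance of `𝒢` at `U = 1` (any dimension) -/

section Shift

variable {d : ℕ} (N : Fin d → ℕ) [hN : ∀ μ, NeZero (N μ)]

/-- `(S_ν A)((x, κ), j) = A((x + e_ν, κ), j)`. [folklore] -/
theorem shiftM_mul_apply (ν : Fin d) (A : Matrix (Tor N × Fin d) (Tor N × Fin d) ℂ)
    (i j : Tor N × Fin d) : (shiftM N ν * A) i j = A (i.1 + unitVec N ν, i.2) j := by
  rw [Matrix.mul_apply, Finset.sum_eq_single (i.1 + unitVec N ν, i.2)]
  · simp [shiftM]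
  · intro k _ hk
    simp [shiftM, hk]
  · intro h; exact absurd (Finset.mem_univ _) h

/-- `(A S_ν)(i, (y, κ)) = A(i, (y − e_ν, κ))`. [folklore] -/
theorem mul_shiftM_apply (ν : Fin d) (A : Matrix (Tor N × Fin d) (Tor N × Fin d) ℂ)
    (i j : Tor N × Fin d) : (A * shiftM N ν) i j = A i (j.1 - unitVec N ν, j.2) := by
  rw [Matrix.mul_apply, Finset.sum_eq_single (j.1 - unitVec N ν, j.2)]
  · simp [shiftM]
  · intro k _ hk
    have hne : j ≠ (k.1 + unitVec N ν, k.2) := by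
      rintro rfl
      exact hk (by simp)
    simp [shiftM, hne]
  · intro h; exact absurd (Finset.mem_univ _) h

/-- `(S_ν^m A)((x, κ), j) = A((x + m e_ν, κ), j)`. [folklore] -/
theorem shiftM_pow_mul_apply (ν : Fin d) (m : ℕ) (A : Matrix (Tor N × Fin d) (Tor N × Fin d) ℂ)
    (i j : Tor N × Fin d) : (shiftM N ν ^ m * A) i j = A (i.1 + m • unitVec N ν, i.2) j := by
  induction m generalizing A with
  | zero => simp
  | succ m ih =>
    rw [pow_succ, Matrix.mul_assoc, ih, shiftM_mul_apply]
    simp only [succ_nsmul, add_assoc]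

/-- `(A S_ν^m)(i, (y, κ)) = A(i, (y − m e_ν, κ))`. [folklore] -/
theorem mul_shiftM_pow_apply (ν : Fin d) (m : ℕ) (A : Matrix (Tor N × Fin d) (Tor N × Fin d) ℂ)
    (i j : Tor N × Fin d) : (A * shiftM N ν ^ m) i j = A i (j.1 - m • unitVec N ν, j.2) := by
  induction m generalizing A with
  | zero => simp
  | succ m ih =>
    rw [pow_succ', ← Matrix.mul_assoc, ih, mul_shiftM_apply]
    simp only [succ_nsmul, sub_add_eq_sub_sub]

/-- `U S_ν^m = diag(e^{2πi m p_ν / N_ν}) U`. [folklore] -/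
theorem dftV_mul_shiftM_pow (ν : Fin d) (m : ℕ) :
    dftV N * shiftM N ν ^ m
      = Matrix.diagonal (fun i : Tor N × Fin d => (ZMod.stdAddChar (N := N ν)) (i.1 ν) ^ m)
        * dftV N := by
  induction m with
  | zero => simp
  | succ m ih =>
    rw [pow_succ, ← Matrix.mul_assoc, ih, Matrix.mul_assoc, dftV_mul_shiftM, ← Matrix.mul_assoc,
      Matrix.diagonal_mul_diagonal]
    simp only [pow_succ]

end Shift

section BlockCov

variable {d : ℕ} (n : ℕ) [NeZero n] (hn : 1 ≤ n) (M : Fin d → ℕ) [hM : ∀ μ, NeZero (M μ)]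
  (a : ℝ) (ha : 0 < a)

/-- a Fourier multiplier CONSTANT ON THE COSETS `p = p′ + l` commutes with the block-diagonal
`Ĝ`. [folklore] -/
theorem diagonal_mul_calGhat_comm {g : Tor (fine n M) × Fin d → ℂ} {f : Tor M → ℂ}
    (hg : ∀ I, g (B5Prop11Plancherel.emb n M I) = f I.2) :
    Matrix.diagonal g * calGhat n hn M a ha = calGhat n hn M a ha * Matrix.diagonal g := by
  have hP : ∀ P, g P = f (B5Prop11Plancherel.blockEquiv n M P).2 := fun P => by
    conv_lhs =>
      rw [← (B5Prop11Plancherel.blockEquiv n M).symm_apply_apply P,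
        B5Prop11Plancherel.blockEquiv_symm_apply]
    exact hg _
  ext P P'
  rw [Matrix.diagonal_mul, Matrix.mul_diagonal, hP P, hP P']
  simp only [calGhat, Matrix.reindex_symm, Matrix.reindex_apply, Equiv.symm_symm,
    Matrix.submatrix_apply, Matrix.blockDiagonal_apply]
  split_ifs with h
  · rw [h, mul_comm]
  · simp

/-- the phase `e^{2πi n p_ν/(n M_ν)}` of the block translation `n e_ν` at the fine momentum
`p = p′ + l` depends only on the coset `p′`. [folklore] -/
theorem phase_pow_emb (ν : Fin d) (I : ((Fin d → Fin n) × Fin d) × Tor M) :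
    (ZMod.stdAddChar (N := fine n M ν)) ((B5Prop11Plancherel.emb n M I).1 ν) ^ n
      = (ZMod.stdAddChar (N := fine n M ν))
          ((((n : ℤ) * (I.2 ν).valMinAbs : ℤ) : ZMod (fine n M ν))) := by
  rw [← AddChar.map_nsmul_eq_pow, nsmul_eq_mul]
  congr 1
  simp only [B5Prop11Plancherel.emb]
  push_cast
  have h0 : ((n : ZMod (fine n M ν)) * (M ν : ZMod (fine n M ν))) = 0 := by
    rw [← Nat.cast_mul]
    exact ZMod.natCast_self (n * M ν)
  linear_combination (((I.1.1 ν : ℕ) : ZMod (fine n M ν))) * h0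

/-- **BLOCK TRANSLATIONS COMMUTE WITH `𝒢 = Δ_a⁻¹` (at `U = 1`)**: `S_ν^n 𝒢 = 𝒢 S_ν^n` — the
phase of the translation by one block side `n e_ν` is constant on the cosets `p = p′ + l`, hence
commutes with the block-diagonal `Ĝ`. [folklore] -/
theorem shiftM_pow_mul_calG (ν : Fin d) :
    shiftM (fine n M) ν ^ n * calG n hn M a ha = calG n hn M a ha * shiftM (fine n M) ν ^ n := by
  set D : Matrix (Tor (fine n M) × Fin d) (Tor (fine n M) × Fin d) ℂ :=
    Matrix.diagonal (fun i : Tor (fine n M) × Fin d =>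
      (ZMod.stdAddChar (N := fine n M ν)) (i.1 ν) ^ n) with hD
  have hF : dftV (fine n M) * shiftM (fine n M) ν ^ n = D * dftV (fine n M) :=
    dftV_mul_shiftM_pow (fine n M) ν n
  have hS : shiftM (fine n M) ν ^ n = star (dftV (fine n M)) * (D * dftV (fine n M)) := by
    rw [← hF, ← Matrix.mul_assoc, star_dftV_mul, Matrix.one_mul]
  have hDG : D * calGhat n hn M a ha = calGhat n hn M a ha * D :=
    diagonal_mul_calGhat_comm n hn M a ha
      (f := fun q : Tor M =>
        (ZMod.stdAddChar (N := fine n M ν)) ((((n : ℤ) * (q ν).valMinAbs : ℤ) : ZMod (fine n M ν))))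
      (fun I => phase_pow_emb n M ν I)
  rw [hS, calG]
  simp only [Matrix.mul_assoc]
  rw [← Matrix.mul_assoc (dftV (fine n M)) (star (dftV (fine n M))), dftV_mul_star,
    Matrix.one_mul, ← Matrix.mul_assoc (dftV (fine n M)) (star (dftV (fine n M))), dftV_mul_star,
    Matrix.one_mul, ← Matrix.mul_assoc D, hDG, Matrix.mul_assoc]

/-- **BLOCK-TRANSLATION COVARIANCE OF THE ENTRIES OF `𝒢`** (at `U = 1`):
`𝒢((x + n e_ν, κ), (y + n e_ν, κ′)) = 𝒢((x, κ), (y, κ′))`. [folklore] -/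
theorem calG_blockShift (ν : Fin d) (x y : Tor (fine n M)) (κ κ' : Fin d) :
    calG n hn M a ha (x + n • unitVec (fine n M) ν, κ) (y + n • unitVec (fine n M) ν, κ')
      = calG n hn M a ha (x, κ) (y, κ') := by
  have h := congr_fun (congr_fun (shiftM_pow_mul_calG n hn M a ha ν) (x, κ))
    (y + n • unitVec (fine n M) ν, κ')
  rw [shiftM_pow_mul_apply, mul_shiftM_pow_apply] at h
  simpa using h

omit [NeZero n] hM in
/-- the lattice `Σ_ν ℤ · n e_ν` of BLOCK TRANSLATIONS of the fine torus `Π_μ ℤ/(n M_μ)`.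
[folklore] -/
def blockSteps : AddSubgroup (Tor (fine n M)) :=
  AddSubgroup.closure (Set.range fun ν : Fin d => n • unitVec (fine n M) ν)

omit [NeZero n] hM in
/-- `n e_ν` is a block translation. [folklore] -/
theorem nsmul_unitVec_mem_blockSteps (ν : Fin d) : n • unitVec (fine n M) ν ∈ blockSteps n M :=
  AddSubgroup.subset_closure ⟨ν, rfl⟩

omit [NeZero n] hM in
/-- `castT (n z)`, `z ∈ ℤ^d`, is a block translation. [folklore] -/
theorem castT_blockVec_mem_blockSteps (z : Fin d → ℤ) :
    castT (fine n M) (fun μ => (n : ℤ) * z μ) ∈ blockSteps n M := by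
  rw [← Finset.univ_sum_single (castT (fine n M) (fun μ => (n : ℤ) * z μ))]
  refine AddSubgroup.sum_mem _ fun ν _ => ?_
  have h : Pi.single (M := fun μ => ZMod (fine n M μ)) ν
        (castT (fine n M) (fun μ => (n : ℤ) * z μ) ν)
      = z ν • (n • unitVec (fine n M) ν) := by
    rw [unitVec, ← Pi.single_smul, ← Pi.single_smul]
    congr 1
    simp only [castT, zsmul_eq_mul, nsmul_eq_mul, mul_one]
    push_cast
    ring
  rw [h]
  exact AddSubgroup.zsmul_mem _ (nsmul_unitVec_mem_blockSteps n M ν) _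

/-- **the entries of `𝒢` are invariant under simultaneous block translation of both sites.**
[folklore] -/
theorem calG_translate {T : Tor (fine n M)} (hT : T ∈ blockSteps n M) (x y : Tor (fine n M))
    (κ κ' : Fin d) :
    calG n hn M a ha (x + T, κ) (y + T, κ') = calG n hn M a ha (x, κ) (y, κ') := by
  induction hT using AddSubgroup.closure_induction generalizing x y with
  | mem T hT =>
    obtain ⟨ν, rfl⟩ := hT
    exact calG_blockShift n hn M a ha ν x y κ κ'
  | zero => simp
  | add T₁ T₂ _ _ ih₁ ih₂ => rw [← add_assoc, ← add_assoc, ih₂, ih₁]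
  | neg T _ ih =>
    have h := ih (x + -T) (y + -T)
    simp only [neg_add_cancel_right] at h
    exact h.symm

end BlockCov

section ReadingCov

variable (n : ℕ) [NeZero n] (hn : 1 ≤ n) (M : Fin 4 → ℕ) [hM : ∀ μ, NeZero (M μ)] (a : ℝ)
  (ha : 0 < a)

/-- **the READING `rd` of `𝒢` is invariant under block translation of the base point**: a base
point relabelled by a WRAPPED shift (translation by `e_μ` modulo the block lattice) reads the
same kernel as the translated one. [folklore] -/
theorem rd_translate {T : Tor (fine n M)} (hT : T ∈ blockSteps n M) (x₀ : Tor (fine n M))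
    (κ ν₀ : Fin 4) (φ : ℂ →+ ℝ) (v : DyadicShell.Pt) :
    rd n hn M a ha (x₀ + T) κ ν₀ φ v = rd n hn M a ha x₀ κ ν₀ φ v := by
  simp only [rd, rdM]
  rw [add_right_comm, calG_translate n hn M a ha hT]

end ReadingCov

/-! ## §9 The wall form for WRAPPED shifts (shift = translation by `e_μ` modulo block translations) -/

section WallMod

variable {τ : Type} {κB : Type*} (Mv : ℕ+ × τ → Fin 4 → ℕ) [hMv : ∀ i ρ, NeZero (Mv i ρ)]
  (a : ℝ) (ha : 0 < a)

/-- **THE TORUS-SIDE ROWS OF THE VOLUME SEAM FOR A WRAPPED SHIFT.**  As `wall_rows`, but the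
relabelling `sh n` of base points is only required to translate the source site by `e_μ` MODULO A
BLOCK TRANSLATION (`X₀ (sh b) − (X₀ b + e_μ) ∈ blockSteps`, e.g. the cyclic shift `b ↦ b + e_μ`
inside one `n`-block, which preserves a finite block `Bset n` as the wall's `hshB` demands); by
the block-translation covariance of `𝒢` (`rd_translate`) the readings are those of the translated
base point, and the four rows `d0T / d1T / d1×T / d2×T` follow with the same constants.
[folklore] -/
theorem wall_rows_mod
    (h12 : B5.Prop12Printed (fam (fun i : ℕ+ × τ => ((i.1 : ℕ+) : ℕ)) (fun i => i.1.pos) Mv a ha))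
    (h126 : B5.Kernel126_127Printed (kfam (fun i : ℕ+ × τ => ((i.1 : ℕ+) : ℕ)) Mv))
    {l : Filter τ} (hgrow : ∀ (m : ℕ+) (ρ : Fin 4), Tendsto (fun t => (m : ℕ) * Mv (m, t) ρ) l atTop)
    (X₀ : (i : ℕ+ × τ) → κB → Tor (fine ((i.1 : ℕ+) : ℕ) (Mv i))) (kk nn : ℕ → κB → Fin 4)
    (φ : ℂ →+ ℝ) (hφ : ∀ z, |φ z| ≤ ‖z‖) (Bset : ℕ → Finset κB) (sh : ℕ → Equiv.Perm κB)
    {μ ν : Fin 4}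
    (hX : ∀ (m : ℕ+) (t : τ), ∀ b ∈ Bset m,
      X₀ (m, t) (sh m b) - (X₀ (m, t) b + unitVec (fine (m : ℕ) (Mv (m, t))) μ)
        ∈ blockSteps (m : ℕ) (Mv (m, t)))
    (hk : ∀ m : ℕ, ∀ b ∈ Bset m, kk m (sh m b) = kk m b)
    (hν : ∀ m : ℕ, ∀ b ∈ Bset m, nn m (sh m b) = nn m b) :
    ∃ (δ : ℝ) (A : ℕ → ℝ), 0 < δ ∧ (∀ j, 0 ≤ A j) ∧
      (∀ n : ℕ, 2 ≤ n → ∀ b ∈ Bset n, ∀ v : DyadicShell.Pt, v ≠ 0 → ∀ᶠ t in l,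
        |GT Mv a ha X₀ kk nn φ n b t v| ≤
          A 0 * Real.exp (-(δ / n) * DyadicShell.supNorm v) / (DyadicShell.supNorm v : ℝ) ^ 2) ∧
      (∀ n : ℕ, 2 ≤ n → ∀ b ∈ Bset n, ∀ v : DyadicShell.Pt, v ≠ 0 → ∀ ρ : Fin 4, ∀ᶠ t in l,
        |GT Mv a ha X₀ kk nn φ n b t (v + BubbleTransfer.unitVec ρ) - GT Mv a ha X₀ kk nn φ n b t v| ≤
          A 1 * Real.exp (-(δ / n) * DyadicShell.supNorm v) / (DyadicShell.supNorm v : ℝ) ^ 3) ∧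
      (∀ n : ℕ, 2 ≤ n → ∀ b ∈ Bset n, ∀ v : DyadicShell.Pt, v ≠ 0 → ∀ᶠ t in l,
        |GT Mv a ha X₀ kk nn φ n (sh n b) t v - GT Mv a ha X₀ kk nn φ n b t v| ≤
          A 3 * Real.exp (-(δ / n) * DyadicShell.supNorm v) / (DyadicShell.supNorm v : ℝ) ^ 3) ∧
      (∀ n : ℕ, 2 ≤ n → ∀ b ∈ Bset n, ∀ v : DyadicShell.Pt, v ≠ 0 → ∀ᶠ t in l,
        |GT Mv a ha X₀ kk nn φ n b t (v + BubbleTransfer.unitVec μ + BubbleTransfer.unitVec ν) -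
            GT Mv a ha X₀ kk nn φ n b t (v + BubbleTransfer.unitVec μ) -
            (GT Mv a ha X₀ kk nn φ n (sh n b) t (v + BubbleTransfer.unitVec ν) -
              GT Mv a ha X₀ kk nn φ n (sh n b) t v)| ≤
          A 2 * Real.exp (-(δ / n) * DyadicShell.supNorm v) / (DyadicShell.supNorm v : ℝ) ^ 4) := by
  obtain ⟨δ, A, hδ, hA, h⟩ :=
    legs_pt_A (fun i : ℕ+ × τ => ((i.1 : ℕ+) : ℕ)) (fun i => i.1.pos) Mv a ha h12 h126
  -- every fixed `v` is eventually in the faithful box of the instance `(n, t)`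
  have box : ∀ (n : ℕ) (h0 : 0 < n) (v : DyadicShell.Pt),
      ∀ᶠ t in l, InBox (fine (PNat.val ⟨n, h0⟩) (Mv (⟨n, h0⟩, t))) v := fun n h0 v =>
    eventually_inBox (fun i : ℕ+ × τ => ((i.1 : ℕ+) : ℕ)) Mv (fun t => ((⟨n, h0⟩ : ℕ+), t))
      (hgrow ⟨n, h0⟩) v
  -- the wrapped shift reads as the translated base point
  have shift : ∀ (n : ℕ) (h0 : 0 < n) (t : τ), ∀ b ∈ Bset n, ∀ w : DyadicShell.Pt,
      rd (PNat.val ⟨n, h0⟩) (PNat.pos _) (Mv (⟨n, h0⟩, t)) a ha (X₀ (⟨n, h0⟩, t) (sh n b))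
          (kk n (sh n b)) (nn n (sh n b)) φ w
        = rd (PNat.val ⟨n, h0⟩) (PNat.pos _) (Mv (⟨n, h0⟩, t)) a ha
            (X₀ (⟨n, h0⟩, t) b + unitVec (fine (PNat.val ⟨n, h0⟩) (Mv (⟨n, h0⟩, t))) μ)
            (kk n b) (nn n b) φ w := by
    intro n h0 t b hb w
    have hT : X₀ (⟨n, h0⟩, t) (sh n b) -
        (X₀ (⟨n, h0⟩, t) b + unitVec (fine (PNat.val ⟨n, h0⟩) (Mv (⟨n, h0⟩, t))) μ)
          ∈ blockSteps (PNat.val ⟨n, h0⟩) (Mv (⟨n, h0⟩, t)) := hX ⟨n, h0⟩ t b hb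
    have hX' : X₀ (⟨n, h0⟩, t) (sh n b) =
        X₀ (⟨n, h0⟩, t) b + unitVec (fine (PNat.val ⟨n, h0⟩) (Mv (⟨n, h0⟩, t))) μ +
          (X₀ (⟨n, h0⟩, t) (sh n b) -
            (X₀ (⟨n, h0⟩, t) b + unitVec (fine (PNat.val ⟨n, h0⟩) (Mv (⟨n, h0⟩, t))) μ)) := by
      abel
    rw [hX', rd_translate _ _ _ a ha hT, hk n b hb, hν n b hb]
  refine ⟨δ, A, hδ, hA, ?_, ?_, ?_, ?_⟩
  · intro n hn b hb v hv
    have h0 : 0 < n := by omega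
    filter_upwards [box n h0 v] with t ht
    rw [GT_pos Mv a ha X₀ kk nn φ h0]
    exact (h (⟨n, h0⟩, t) (X₀ _ b) (kk n b) (nn n b) φ hφ v hv ht).1
  · intro n hn b hb v hv ρ
    have h0 : 0 < n := by omega
    filter_upwards [box n h0 v] with t ht
    rw [GT_pos Mv a ha X₀ kk nn φ h0, GT_pos Mv a ha X₀ kk nn φ h0]
    exact (h (⟨n, h0⟩, t) (X₀ _ b) (kk n b) (nn n b) φ hφ v hv ht).2.1 ρ
  · intro n hn b hb v hv
    have h0 : 0 < n := by omega
    filter_upwards [box n h0 v] with t ht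
    rw [GT_pos Mv a ha X₀ kk nn φ h0, GT_pos Mv a ha X₀ kk nn φ h0, shift n h0 t b hb]
    exact (h (⟨n, h0⟩, t) (X₀ _ b) (kk n b) (nn n b) φ hφ v hv ht).2.2.1 μ
  · intro n hn b hb v hv
    have h0 : 0 < n := by omega
    filter_upwards [box n h0 v] with t ht
    rw [GT_pos Mv a ha X₀ kk nn φ h0, GT_pos Mv a ha X₀ kk nn φ h0, GT_pos Mv a ha X₀ kk nn φ h0,
      GT_pos Mv a ha X₀ kk nn φ h0, shift n h0 t b hb, shift n h0 t b hb]
    exact (h (⟨n, h0⟩, t) (X₀ _ b) (kk n b) (nn n b) φ hφ v hv ht).2.2.2 μ ν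

end WallMod

end

end Literature.MathematicalPhysics.QuantumFieldTheory.Balaban1983to89.Beta.VectorTailsPt
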